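/-
COR-CM (cells pub-hodgecm / pub-hodgecm2, stage 2 of the Hodge ladder) — TRANSPOSITION SURGE, item (vi) sub-binder S2 / (vi-2)
`supply`; pin-2 = prover-pub-hodgecm2-pin-2-0 (owner of record of `hCMisogE`, coordinator ruling 2026-08-21T18:44:30Z).  The
σ-PARAMETRIC TWIN of `Model.faceSupply_of_thm418AsPrinted_pinned_isog` (`Transposition/Item6PinMatch.lean`, p297494 ✔): the PIN
EMBEDDING `σ` of the CM side (along which Liu's `A_μ` is base-changed) is a PARAMETER instead of the face embedding `ι₁` — so that the
package P2′ of TEAM hComp (pin along `σ = conj ∘ ι₁`, s2crux-idea-1 ROUTES §8 / pub-hodgecm2 INBOX 2026-08-21T18:58:21Z) and the record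
(`σ = ι₁`) are both instances.  Theorems only; nothing landed is edited or restated.  FRAMING: HC_CM is NOT proved.
-/
import Literature.NumberTheory.Automorphic.Liu2021.Thm418Invariants
import Literature.NumberTheory.Automorphic.IdeleClassCharacterValueFieldCM
import Summits.HodgeConjecture.CorCM.B01.Transposition.Item6SupplyReach
import Summits.HodgeConjecture.CorCM.LiuValueFieldPin
import HarnessLib

/-!
# Item (vi) S2 at a consumer's pin ALONG AN ARBITRARY EMBEDDING `σ` — the isogeny-invariant CM side, σ-parametric

`Model.faceSupply_of_thm418AsPrinted_pinned_isog` (landed) identifies the embedding along which the CM side is read (the inverse type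
`Φ_μ = Φ^{*ι₁}`, the inclusion `e_μ : K* = ι₁⁻¹(M'_μ) → M_μ`, the reflex type `reflexCMType ι₁ Φ_μ id`) with the FACE embedding `ι₁`
(`ι₁ ∈ Φ`, `V` of signature `(2,1)` at `ι₁|_{F⁺}`).  [Liu2021] Def. 4.5 is INTRINSIC over `E` (`FJcycle.tex` l. 1936–1958: the determinant
of `i_μ(x)` on `Lie_E(A_μ)`, the CM character w.r.t. `M_μ ⊂ ℂ` — no complex embedding of `E` occurs), and `μ ↦ μ^c` («conjugate symplectic
of the same weight; `M_{μ^c} = M_μ`, `M'_{μ^c} = M'_μ`, `Ψ_{μ^c}` the opposite type», Rem. 4.4 l. 1930–1932; `D_μ ↦ D_μ^∨`,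
`𝒜(μ)^{op} ≃ 𝒜(μ^c)`, Prop. 4.6 (2) l. 1971) exchanges the readings along `ι₁` and `ῑ₁ = conj ∘ ι₁`.  Hence the honest general form of
the junction takes the PIN EMBEDDING as a parameter `σ F ι₁ V Φ : F →+* ℂ`:

* `hμσ` — the CHOICE of the datum's `μ`: `Φ_μ = Φ^{*σ}` (inverse type through `σ`; item (ii) `Transposition.invType σ Φ`);
* `hCMisogσ` — Def. 4.5 (2) read UP TO ISOGENY along `σ`: for Liu's `M_μ = muAlgValueField F μ` (l. 1928) and THE inclusion
  `e : K*_σ = σ⁻¹(M'_μ) → M_μ`, `(e k : ℂ) = σ k` (Def. 4.3 (2) l. 1919), the pin `Aμ … D_μ` (intended `A_μ ⊗_{E,σ} ℂ`) is ISOGENOUS to an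
  `𝓞_{M_μ}`-realisation of `inducedCMType e (reflexCMType σ Φ_μ id)` (the type of `A_μ ⊗_{E,σ} ℂ` over `M_μ`, Def. 4.5 (2) first bullet
  l. 1947–1949 read through `σ`);
* all other binders (`hLiu` Thm. 4.18 as printed l. 2232–2245, `hObj` Prop. 4.6 (1) l. 1969, `hChi`/`hirr`/`hsm` Def. 4.11 l. 2090–2096
  with App. D Lem. D.1 (1) l. 5226–5229 at `n = 3` for the non-vanishing carried by Mathlib's `IsIrreducible`, `hReach` = own-htheta's
  §4.2 + App. C Prop. C.5 reach VERBATIM at the pin `Aμ`) exactly as in the landed junction.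
KERNEL: item6-p3 `Thm418Data.exists_homK_ne_zero_of_irreducible_smooth`, `hReach`, binder-1 `CMReach.comp_ne_zero_of_isIsogeny`,
`Model.exists_ringHom_reflexField_muAlgValueField` (at `σ`) and `Model.exists_hom_cmAV_ne_zero_of_isInverse_reflex` (at `σ`; Shimura §6 over
Riemann + §8.3 Prop. 28 — generic in the embedding), item6-p1 `Model.faceSupply_of_albaneseFactor` (at the face's `ι₁ ∈ Φ`).
`σ := fun F ι₁ V Φ => ι₁` recovers `faceSupply_of_thm418AsPrinted_pinned_isog`; `σ := fun F ι₁ V Φ => (starRingEnd ℂ).toRingHom.comp ι₁`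
is the CM side of package P2′.  No degree- or face-specific input.  HC_CM is NOT proved; `hCMisogσ`, `hReach` are not inhabited here.

References: Y. Liu, *Fourier–Jacobi cycles and arithmetic relative trace formula*, Camb. J. Math. 9 (2021) = arXiv:2102.11518
(`FJcycle.tex` md5 6db49a74122d): Def. 4.3 (2) l. 1919, §4.1 l. 1928, Rem. 4.4 l. 1930–1932, Def. 4.5 l. 1936–1964, Prop. 4.6 l. 1966–1971,
Def. 4.11 l. 2083–2097, Thm. 4.18 l. 2232–2245, App. D Lem. D.1 (1) l. 5226–5229; G. Shimura, *Abelian Varieties with Complex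
Multiplication and Modular Functions* (1998) §6.2 Thm. 3, §8.3 Prop. 28; D. Mumford, *Abelian Varieties* §19.
-/

noncomputable section

open scoped TensorProduct InnerProductSpace

namespace Summit.HodgeConjecture.CorCM.Model

open CategoryTheory AlgebraicGeometry NumberField
open Literature.AlgebraicGeometry.Motives
open Literature.AlgebraicGeometry.HodgeTheory
open Literature.AlgebraicGeometry.ComplexMultiplication (IsCMTypeRealisation)
open Literature.NumberTheory.ComplexMultiplication
open Literature.NumberTheory.Automorphic
open Literature.NumberTheory.Automorphic.IdeleClassGroup
open Literature.NumberTheory.Automorphic.PicardCM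
open Literature.NumberTheory.Automorphic.Liu2021

/-- **B01-S from [Liu 2021, Thm. 4.18] AS PRINTED at a consumer's pin read ALONG `σ`** (`U = picardCMUniverse hHD hI h₁ h₃`; the
σ-parametric twin of `Model.faceSupply_of_thm418AsPrinted_pinned_isog`): per face context `(F, ι₁, V)` with `ι₁ ∈ Φ` the consumer
also supplies the PIN EMBEDDING `σ F ι₁ V Φ : F →+* ℂ` (record: `ι₁`; package P2′: `conj ∘ ι₁`); `hμσ` = choice `Φ_μ = Φ^{*σ}`;
`hCMisogσ` = [Liu2021] Def. 4.5 (2) (l. 1944–1951, RATIONAL `i_μ` l. 1947; first bullet l. 1947–1949) with Def. 4.3 (2) l. 1919 and §4.1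
l. 1928, read UP TO ISOGENY along `σ` (`Aμ … D_μ` isogenous to an `𝓞_{M_μ}`-realisation of `inducedCMType e (reflexCMType σ Φ_μ id)`, `e` the
σ-compatible inclusion `K*_σ → M_μ`); `hLiu` (Thm. 4.18 l. 2232–2245), `hObj` (Prop. 4.6 (1) l. 1969), `hChi`/`hirr`/`hsm` (Def. 4.11
l. 2090–2096 + App. D Lem. D.1 (1) l. 5226–5229 at `n = 3`), `hReach` (§4.2 + App. C Prop. C.5 at the pin) as in the landed junction.
HC_CM is NOT proved; `hCMisogσ`, `hReach` are not inhabited here.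
[cite: Liu2021, Thm. 4.18 (FJcycle.tex l. 2232–2245), Def. 4.5 (2) (l. 1944–1951), Rem. 4.4 (l. 1930–1932) and Def. 4.3 (2) (l. 1919)]
[cite: Shimura1998, §6.2 Theorem 3 and §8.3 Prop. 28] [cite: MumfordAV1970, §19 Remark p. 169] -/
theorem faceSupply_of_thm418AsPrinted_pinned_isog_along
    (hHD : exists_isReal_hodgeModel) (hI : hodgePQ_independent_of_hodgeModel)
    (h₁ : BallQuotientUniformised) (h₃ : CMAbelianVarietyRealised)
    (D : ∀ (F : CMField) (ι₁ : F →+* ℂ) (_ : HermSpace3 F ι₁) (_ : CMType F), Thm418Data (maximalRealSubfield F) F)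
    (σ : ∀ (F : CMField) (ι₁ : F →+* ℂ) (_ : HermSpace3 F ι₁) (_ : CMType F), F →+* ℂ)
    (Aμ : ∀ (F : CMField) (ι₁ : F →+* ℂ) (V : HermSpace3 F ι₁) (Φ : CMType F), (D F ι₁ V Φ).Obj → AbelianVariety ℂ)
    (hLiu : ∀ (F : CMField), IsGalois ℚ F → 6 ≤ Module.finrank ℚ F → ∀ (Φ : CMType F) (ι₁ : F →+* ℂ), ι₁ ∈ Φ.1 →
      ∀ V : HermSpace3 F ι₁, Thm418AsPrinted (D F ι₁ V Φ))
    (hObj : ∀ (F : CMField), IsGalois ℚ F → 6 ≤ Module.finrank ℚ F → ∀ (Φ : CMType F) (ι₁ : F →+* ℂ), ι₁ ∈ Φ.1 →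
      ∀ V : HermSpace3 F ι₁, Nonempty (D F ι₁ V Φ).Obj)
    (hChi : ∀ (F : CMField), IsGalois ℚ F → 6 ≤ Module.finrank ℚ F → ∀ (Φ : CMType F) (ι₁ : F →+* ℂ), ι₁ ∈ Φ.1 →
      ∀ V : HermSpace3 F ι₁, Nonempty (D F ι₁ V Φ).Chi)
    (hirr : ∀ (F : CMField), IsGalois ℚ F → 6 ≤ Module.finrank ℚ F → ∀ (Φ : CMType F) (ι₁ : F →+* ℂ), ι₁ ∈ Φ.1 →
      ∀ (V : HermSpace3 F ι₁) (i : (D F ι₁ V Φ).AdmIndex), ((D F ι₁ V Φ).rhoAt i).IsIrreducible)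
    (hsm : ∀ (F : CMField), IsGalois ℚ F → 6 ≤ Module.finrank ℚ F → ∀ (Φ : CMType F) (ι₁ : F →+* ℂ), ι₁ ∈ Φ.1 →
      ∀ (V : HermSpace3 F ι₁) (i : (D F ι₁ V Φ).AdmIndex) (v : (D F ι₁ V Φ).omegaAt i),
        ∃ S : Subgroup (D F ι₁ V Φ).G, IsOpen (S : Set (D F ι₁ V Φ).G) ∧ ∀ k ∈ S, (D F ι₁ V Φ).rhoAt i k v = v)
    (hμσ : ∀ (F : CMField), IsGalois ℚ F → 6 ≤ Module.finrank ℚ F → ∀ (Φ : CMType F) (ι₁ : F →+* ℂ), ι₁ ∈ Φ.1 →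
      ∀ (V : HermSpace3 F ι₁) (g : F ≃ₐ[ℚ] F),
        (σ F ι₁ V Φ).comp (g : F →+* F) ∈ (D F ι₁ V Φ).cmType.1 ↔ (σ F ι₁ V Φ).comp (g.symm : F →+* F) ∈ Φ.1)
    (hCMisogσ : ∀ (F : CMField) [IsGalois ℚ F], 6 ≤ Module.finrank ℚ F → ∀ (Φ : CMType F) (ι₁ : F →+* ℂ), ι₁ ∈ Φ.1 →
      ∀ (V : HermSpace3 F ι₁) (Dμ : (D F ι₁ V Φ).Obj),
        haveI := (D F ι₁ V Φ).isConjugateSymplectic.numberField_muAlgValueField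
        ∀ e : reflexField ℚ F (algValuedIn (σ F ι₁ V Φ) (D F ι₁ V Φ).cmType.1) →+* muAlgValueField F (D F ι₁ V Φ).μ,
          (∀ k : reflexField ℚ F (algValuedIn (σ F ι₁ V Φ) (D F ι₁ V Φ).cmType.1),
            ((e k : muAlgValueField F (D F ι₁ V Φ).μ) : ℂ) = σ F ι₁ V Φ k) →
          ∃ (B : AbelianVariety ℂ) (g : Aμ F ι₁ V Φ Dμ ⟶ B), AbelianVariety.IsIsogeny g ∧
            ∃ (ιB : 𝓞 (muAlgValueField F (D F ι₁ V Φ).μ) →+* End B)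
              (θB : muAlgValueField F (D F ι₁ V Φ).μ →+* Module.End ℂ (complexBetti B.X 1)),
              IsCMTypeRealisation (inducedCMType e (reflexCMType (σ F ι₁ V Φ) (D F ι₁ V Φ).cmType (AlgHom.id ℚ F))) B ιB θB)
    (hReach : ∀ (F : CMField), IsGalois ℚ F → 6 ≤ Module.finrank ℚ F → ∀ (Φ : CMType F) (ι₁ : F →+* ℂ), ι₁ ∈ Φ.1 →
      ∀ V : HermSpace3 F ι₁, ∃ Ksm : Subgroup (D F ι₁ V Φ).G, IsOpenCompact Ksm ∧
        ∀ (K : Subgroup (D F ι₁ V Φ).G) (Dμ : (D F ι₁ V Φ).Obj) (φ : (D F ι₁ V Φ).HomK K Dμ),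
          IsOpenCompact K → K ≤ Ksm → φ ≠ 0 →
            ∃ (Γ : Level V) (𝒥 : Jacobian (Var.scheme (ballQuotientUniformisedDatum_of h₁) h₃ (.pms (pmsCode F ι₁ V Γ))))
              (w : 𝒥.J ⟶ Aμ F ι₁ V Φ Dμ), w ≠ 0) :
    (picardCMUniverse hHD hI h₁ h₃).FaceSupply := by
  refine faceSupply_of_albaneseFactor hHD hI h₁ h₃ fun F hG h6 Φ ι₁ hι V => ?_
  haveI := hG
  haveI := (D F ι₁ V Φ).isConjugateSymplectic.numberField_muAlgValueField
  haveI := (D F ι₁ V Φ).isConjugateSymplectic.isCMField_muAlgValueField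
  obtain ⟨χ⟩ := hChi F hG h6 Φ ι₁ hι V
  obtain ⟨Dμ⟩ := hObj F hG h6 Φ ι₁ hι V
  obtain ⟨e, he⟩ := exists_ringHom_reflexField_muAlgValueField F (σ F ι₁ V Φ) (D F ι₁ V Φ).cmType
    (D F ι₁ V Φ).isConjugateSymplectic (D F ι₁ V Φ).isConjugateSymplectic.hasCMType_cmType
  obtain ⟨Ksm, hKsm, hreach⟩ := hReach F hG h6 Φ ι₁ hι V
  obtain ⟨K₀, hK₀, hK⟩ := Thm418Data.exists_homK_ne_zero_of_irreducible_smooth (hLiu F hG h6 Φ ι₁ hι V) Dμ χ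
    (hirr F hG h6 Φ ι₁ hι V) (hsm F hG h6 Φ ι₁ hι V)
  have hKK : IsOpenCompact (K₀ ⊓ Ksm) := by
    refine ⟨?_, ?_⟩ <;> rw [Subgroup.coe_inf]
    · exact hK₀.1.inter hKsm.1
    · exact hK₀.2.inter_right (Subgroup.isClosed_of_isOpen Ksm hKsm.1)
  obtain ⟨φ, hφ⟩ := hK (K₀ ⊓ Ksm) hKK inf_le_left
  obtain ⟨Γ, 𝒥, w, hw⟩ := hreach (K₀ ⊓ Ksm) Dμ φ hKK inf_le_right hφ
  obtain ⟨B, g, hg, ιB, θB, hB⟩ := hCMisogσ F h6 Φ ι₁ hι V Dμ e he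
  exact ⟨Γ, 𝒥, exists_hom_cmAV_ne_zero_of_isInverse_reflex h₃ F (σ F ι₁ V Φ) (hμσ F hG h6 Φ ι₁ hι V) e hB
    (CMReach.comp_ne_zero_of_isIsogeny hg hw)⟩

end Summit.HodgeConjecture.CorCM.Model

end
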